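import Literature.NumberTheory.Automorphic.ReciprocityGLn
import HarnessLib

/-!
# Shavali 2026, Theorem A: irreducibility of `ρ_{π,λ}` for regular algebraic cuspidal `π` on `GL_4`
# over a totally real field, `π` not essentially self-dual (named fact, UNREFEREED claim)

Topic `NumberTheory/Automorphic`; namespace `Literature.NumberTheory.Automorphic`.

Source: A. Shavali, *Irreducibility and Monodromy of Automorphic Galois Representations of
`GL(4)`*, arXiv:2603.19768 (March 2026) [Shavali2026GL4]; quotations from the held arXiv text
(`paper:arxiv-2603.19768`, pp. 3, 10, 12).

> **Theorem A.** "Let `K` be totally real and `π` be a regular algebraic cuspidal automorphic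
> representation of `GL_4(𝔸_K)` and assume that `π` is not essentially self-dual. Then `ρ_{π,𝔭}` is
> irreducible for any finite place `𝔭` of `E`."  (`E = ℚ(π)`; `{ρ_{π,𝔭}}` the compatible family of
> `E`-rational `p`-adic Galois representations attached to `π` by Harris–Lan–Taylor–Thorne / Scholze.)
> **Corollary 4.6.** "Let `K` be a totally real field and `π` be a regular algebraic cuspidal
> automorphic representation of `GL_4(𝔸_K)` that is not essentially self-dual. Then for each embedding
> `λ : ℚ(π) ↪ ℚ̄_p`, the Galois representation `ρ_{π,λ} : Γ_K → GL_4(ℚ̄_p)` attached to `π` is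
> irreducible."
> (Proof, §4: if `π` is self-twisted it is induced from `GL_2` over a quadratic, necessarily totally
> real or CM, extension and one is reduced to the Hilbert modular / CM case; otherwise a
> decomposition `ρ = σ ⊕ τ` is of type `(3,1)` — excluded by Böckle–Hui's theorem on weak abelian
> direct summands applied to `∧² ρ`, Prop. 4.1 — or `(2,2)` — excluded using the cuspidality of
> `∧² π` (Asgari–Raghuram) and potential automorphy of the constituents, §4.2.)

## The statement and its faithfulness

Exactly as for the Böckle–Hui fact `isIrreducible_galoisRep_gl3_totallyReal` (`BockleHuiIrreducibleGL3`,
whose module docstring applies verbatim with `3 ↦ 4`): the tree does not single out *the*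
representation `ρ_{π,λ}`; the existence theorem (lang.S27, `exists_galoisRep_of_regularAlgebraic`)
produces *some* continuous semisimple `r : Γ_K →ₜ* GL_4(ℚ̄_ℓ)` (`GaloisRepresentations.FramedGaloisRep`,
coefficients `PadicAlgCl ℓ`, `ι : PadicAlgCl ℓ ≃+* ℂ` explicit) unramified with arithmetic-Frobenius
characteristic polynomial `arithFrobPolyOfSatake ι q_v 4 α` at every finite `v ∤ ℓ` where `π` has
Satake parameter `α`, and every such `r` is equivalent to `ρ_{π,λ}` for the embedding
`λ = ι⁻¹|_{ℚ(π)}` (Chebotarev + Brauer–Nesbitt, the tree's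
`GaloisRepresentations.FramedGaloisRep.nonempty_equiv_of_hasFrobCharpolyAt_eventually`; `π` has Satake
parameters at all but finitely many places, `AutomorphicRepData.hasSatakeParamAt_cofinite_holds`).
Irreducibility over the algebraically closed `ℚ̄_ℓ` is the absolute irreducibility of the source.

"`π` is not essentially self-dual" (there is no Hecke character `χ` with `π^∨ ≅ π ⊗ χ`) is rendered
at SATAKE LEVEL, in the language of the tree's cuspidal `GL(1)` data (the shape of
`Ramakrishnan2014_selfdualGL3_adjointLift` and of the Langlands route items): there is no cuspidal
`GL(1)` datum `η` (at the level witness `h1`) such that `t_{π,v}⁻¹ = η(ϖ_v) · t_{π,v}` as multisets for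
almost all `v`.  If `π^∨ ≅ π ⊗ χ` then the `GL(1)` datum of `χ` IS such an `η` (`t_{π^∨,v} = t_{π,v}⁻¹`,
`t_{π ⊗ χ, v} = χ(ϖ_v) t_{π,v}`, Jacquet–Shalika); hence the Satake-level hypothesis implies the
printed one, and the fact below is implied by the printed corollary — nothing is strengthened.
`K` totally real (`NumberField.IsTotallyReal`), `n = 4`, `π` cuspidal (`CuspidalAutomorphicRepData`)
and regular algebraic (`IsRegularAlgebraic`), every prime `ℓ` and every `ι`.  UNREFEREED (arXiv v1,
March 2026): tagged as a claim under review (D-0012).  Consumed (as a text hypothesis, verbatim) by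
`Summits/Langlands/Langlands/Theorems/IrreducibilityBySelfDualityIrreducibleOffSectorRankFourTotallyReal`.

## References

* A. Shavali, arXiv:2603.19768 (2026), Thm. A (p. 3), Cor. 4.6 (p. 12), Prop. 4.1, §4.2.
  [Shavali2026GL4]
* G. Böckle, C.-Y. Hui, Math. Ann. 393 (2025), Thm. 1.1, Thm. 1.2. [BockleHui2025]
* M. Harris, K.-W. Lan, R. Taylor, J. Thorne, Res. Math. Sci. 3 (2016), Thm. A (existence of
  `ρ_{π,ι}`). [HarrisLanTaylorThorneRMS2016]
-/

noncomputable section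

open scoped NumberField
open NumberField IsDedekindDomain Filter

namespace Literature.NumberTheory.Automorphic

/-- **Shavali 2026, Theorem A = Corollary 4.6 (irreducibility for regular algebraic cuspidal `π` on
`GL_4` over totally real fields, `π` not essentially self-dual).**  Let `K` be a totally real number
field, `π` a regular algebraic cuspidal automorphic representation of `GL_4(𝔸_K)` that is not
essentially self-dual at Satake level — there is no cuspidal `GL(1)` datum `η` (at the level witness
`h1`) with `t_{π,v}⁻¹ = η(ϖ_v) · t_{π,v}` (as multisets) for almost all `v` — `ℓ` a prime and
`ι : ℚ̄_ℓ ≃+* ℂ`.  Then every continuous semisimple `r : Γ_K →ₜ* GL_4(ℚ̄_ℓ)` satisfying unramified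
local–global compatibility with `(π, ι)` — at every finite `v ∤ ℓ` where `π` has Satake parameter `α`,
`r` is unramified at `v` with arithmetic-Frobenius characteristic polynomial
`arithFrobPolyOfSatake ι q_v 4 α` (the normalisation of `exists_galoisRep_of_regularAlgebraic`,
lang.S27) — is irreducible (`r.toGaloisRep.IsIrreducible`).  Such `r` are exactly the representations
equivalent to `ρ_{π,λ}`, `λ = ι⁻¹|_{ℚ(π)}` (module docstring), so this is implied by the printed
corollary: "Let `K` be a totally real field and `π` be a regular algebraic cuspidal automorphic
representation of `GL_4(𝔸_K)` that is not essentially self-dual. Then for each embedding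
`λ : ℚ(π) ↪ ℚ̄_p`, the Galois representation `ρ_{π,λ} : Γ_K → GL_4(ℚ̄_p)` attached to `π` is
irreducible."  Named fact (D-0014), UNREFEREED claim; `h1`, `hcpt` threaded.  Locator:
arXiv:2603.19768v1, Thm. A (p. 3) and Cor. 4.6 (p. 12).
[claim: Shavali2026GL4, status: under-review] -/
def isIrreducible_galoisRep_gl4_totallyReal_of_not_essSelfDual : Prop :=
  ∀ (K : Type) [Field K] [NumberField K], IsTotallyReal K →
    ∀ (h1 : isCompact_glFiniteIntegralLevel 1 K) (hcpt : isCompact_glFiniteIntegralLevel 4 K)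
      (π : CuspidalAutomorphicRepData 4 K hcpt), π.1.IsRegularAlgebraic →
      (∀ η : CuspidalAutomorphicRepData 1 K h1,
        ¬ ∀ᶠ v : HeightOneSpectrum (𝓞 K) in cofinite, ∀ α : Multiset ℂ, π.1.HasSatakeParamAt v α →
          ∃ e : ℂ, η.1.HasSatakeParamAt v {e} ∧ α.map (fun a => a⁻¹) = α.map (fun a => e * a)) →
      ∀ (ℓ : ℕ) [Fact ℓ.Prime] (ι : PadicAlgCl ℓ ≃+* ℂ)
        (r : GaloisRepresentations.FramedGaloisRep K (PadicAlgCl ℓ) 4), r.toGaloisRep.IsSemisimple →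
        (∀ (v : HeightOneSpectrum (𝓞 K)) (α : Multiset ℂ), π.1.HasSatakeParamAt v α →
            ((ℓ : ℕ) : 𝓞 K) ∉ v.asIdeal →
              r.IsUnramifiedAt v ∧ r.HasFrobCharpolyAt v (arithFrobPolyOfSatake ι v.residueCard 4 α)) →
        r.toGaloisRep.IsIrreducible

/-- Unfolding lemma for `isIrreducible_galoisRep_gl4_totallyReal_of_not_essSelfDual` (its text is
what the Langlands route's rank-four child takes as the hypothesis `h4`). [folklore] -/
theorem isIrreducible_galoisRep_gl4_totallyReal_of_not_essSelfDual_iff :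
    isIrreducible_galoisRep_gl4_totallyReal_of_not_essSelfDual ↔
      ∀ (K : Type) [Field K] [NumberField K], IsTotallyReal K →
        ∀ (h1 : isCompact_glFiniteIntegralLevel 1 K) (hcpt : isCompact_glFiniteIntegralLevel 4 K)
          (π : CuspidalAutomorphicRepData 4 K hcpt), π.1.IsRegularAlgebraic →
          (∀ η : CuspidalAutomorphicRepData 1 K h1,
            ¬ ∀ᶠ v : HeightOneSpectrum (𝓞 K) in cofinite, ∀ α : Multiset ℂ,
              π.1.HasSatakeParamAt v α →
                ∃ e : ℂ, η.1.HasSatakeParamAt v {e} ∧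
                  α.map (fun a => a⁻¹) = α.map (fun a => e * a)) →
          ∀ (ℓ : ℕ) [Fact ℓ.Prime] (ι : PadicAlgCl ℓ ≃+* ℂ)
            (r : GaloisRepresentations.FramedGaloisRep K (PadicAlgCl ℓ) 4),
            r.toGaloisRep.IsSemisimple →
            (∀ (v : HeightOneSpectrum (𝓞 K)) (α : Multiset ℂ), π.1.HasSatakeParamAt v α →
                ((ℓ : ℕ) : 𝓞 K) ∉ v.asIdeal →
                  r.IsUnramifiedAt v ∧
                    r.HasFrobCharpolyAt v (arithFrobPolyOfSatake ι v.residueCard 4 α)) →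
            r.toGaloisRep.IsIrreducible :=
  Iff.rfl

/-- **Existence form.**  Granting Theorem A and the existence of `ρ_{π,ι}`
(`exists_galoisRep_of_regularAlgebraic`, Harris–Lan–Taylor–Thorne / Scholze): for `K` totally real and
`π` regular algebraic cuspidal on `GL_4(𝔸_K)`, not essentially self-dual at Satake level, there is, for
every `ℓ` and `ι`, an **irreducible** continuous `r : Γ_K →ₜ* GL_4(ℚ̄_ℓ)` with the unramified
compatibility of lang.S27. [claim: Shavali2026GL4, status: under-review] -/
theorem exists_isIrreducible_galoisRep_gl4_totallyReal_of_not_essSelfDual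
    (h : isIrreducible_galoisRep_gl4_totallyReal_of_not_essSelfDual)
    (hex : exists_galoisRep_of_regularAlgebraic) {K : Type} [Field K] [NumberField K]
    (hK : IsTotallyReal K) (h1 : isCompact_glFiniteIntegralLevel 1 K)
    (hcpt : isCompact_glFiniteIntegralLevel 4 K) (π : CuspidalAutomorphicRepData 4 K hcpt)
    (hπ : π.1.IsRegularAlgebraic)
    (hnsd : ∀ η : CuspidalAutomorphicRepData 1 K h1,
      ¬ ∀ᶠ v : HeightOneSpectrum (𝓞 K) in cofinite, ∀ α : Multiset ℂ, π.1.HasSatakeParamAt v α →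
        ∃ e : ℂ, η.1.HasSatakeParamAt v {e} ∧ α.map (fun a => a⁻¹) = α.map (fun a => e * a))
    (ℓ : ℕ) [Fact ℓ.Prime] (ι : PadicAlgCl ℓ ≃+* ℂ) :
    ∃ r : GaloisRepresentations.FramedGaloisRep K (PadicAlgCl ℓ) 4,
      r.toGaloisRep.IsIrreducible ∧ r.toGaloisRep.IsSemisimple ∧
        ∀ (v : HeightOneSpectrum (𝓞 K)) (α : Multiset ℂ), π.1.HasSatakeParamAt v α →
          ((ℓ : ℕ) : 𝓞 K) ∉ v.asIdeal →
            r.IsUnramifiedAt v ∧ r.HasFrobCharpolyAt v (arithFrobPolyOfSatake ι v.residueCard 4 α) := by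
  obtain ⟨r, hss, hr⟩ := hex hcpt (Or.inl hK) π hπ ℓ ι
  exact ⟨r, h K hK h1 hcpt π hπ hnsd ℓ ι r hss hr, hss, hr⟩

end Literature.NumberTheory.Automorphic
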